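import Summits.ResolutionOfSingularities.ResolutionOfSingularities.Theorems.HilbertSamuelEliminationSigmaMaxModificationsCorridor3WLadderHybridLow
import HarnessLib

/-!
# [OURS · L1 W4.2] `Corridor3WLadderHybridLowSwallow` — (c-swallow) FOR THE MENU HYBRID `π.hybrid (ofStageOracleE ω)` SPLIT INTO ITS TWO NAMED
# RESIDUALS: (c-rep)From «late blow-ups of the chain point lead to a state between cycles» and (c-menu)From «late POLICY steps through the chain
# point swallow a stratum component through it» (RULING v3.14-22 (FW)); the END-type half is DISCHARGED here

Crux chain w42 (`SigmaMaxModifications`, stmt-ResolutionOfSingularities-18506; conjunct `SigmaMaxModificationsCorridor3`,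
stmt-ResolutionOfSingularities-19249), res-L1-w42-plan-1 RULINGS v3.14-21 (FS), v3.14-22 (FW) «`…WLadderHybridLow.lean` carries ONE extra named σ-row
(c-menu) … with the half «C ⊇ Z_n ⇒ END-type centre» DISCHARGED in the file». Typer res-type-040 (gen 19). Sequel of `…WLadderHybridLow{Defs,Tree,}`
(p533838/p533837/p534481). OURS (cell res-hironaka, slot W4.2); NOT statements of H. Hironaka's manuscript [Hironaka2017] nor of
[CossartJannsenSaito2020]; AI-typed, weaker than expert review. Two `def … : Prop` rows (OPEN binders) + PROVED theorems. Helper vocabulary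
`--supports stmt-ResolutionOfSingularities-19249 --as helper` (counted 0).

THE SPLIT. Along a chain of the hybrid `σ = π.hybrid (StrategyE.ofStageOracleE ω)` (res-L1-type-o1 p526241 / res-D-pv-047 p523856; E7 p532289), a late
step `(C, P')` that σ allows at the state of `X_n` with `x_n ∈ V(C)` is EITHER a policy step of `π` — then (c-menu)From says it swallows a stratum
component through `x_n` — OR a step of the fallback `τ = ofStageOracleE ω` (ΩE: CJS cycle discipline with a boundary-reading stage oracle); by
functionality of σ it IS the chain's step, so by (c-rep)From its next cycle state is `none`, i.e. it is a cycle END (or a cycle of length `0`): its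
centre is the reduced structure on a whole label part `Y_n^{(j)}` (`IsReplayStep.support_eq_part`), which contains `x_n`, hence contains the
label-`j` stratum component through `x_n` — the END-TYPE HALF, PROVED (`IsCanonicalStepΩE.exists_component_subset_of_none`). So
(c-swallow)From ⟸ (c-rep)From ∧ (c-menu)From for the hybrid (`strataSwallowFromσE_hybrid_of_replaySettle_menuSwallow`), and E7's Low class at a
maximal origin follows from (b)From ∧ (c-rep)From ∧ (c-menu)From ∧ units (`low_init_hybrid_of_rows`, through `low_init_of_births_swallow_units`).
The design clause (β) «policy steps emit `P' = none`» (plan-1 (FW), o1 to confirm) is NOT needed for this split — (c-rep)From is stated on the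
chain's next state whatever emitted it.

Contents (namespace `…Theorems.SigmaMaxModificationsCorridor3.Sigma`): defs `StrataReplaySettleFromσE σ N ν s₀ G` ((c-rep)From, any `StrategyE`),
`StrataPolicySwallowFromσE π σ N ν s₀ G` ((c-menu)From: late `π`-steps along `σ`-chains through `x_n` swallow); theorems
`IsCanonicalStepΩE.exists_component_subset_of_none`, `strataSwallowFromσE_hybrid_of_replaySettle_menuSwallow`, `low_init_hybrid_of_rows`.
References: CJS LNM 2270 Rem. 6.29 (1), Prop. 6.31, Thm. 6.35, p. 105, p. 107 [CossartJannsenSaito2020]; tree `Literature…CanonicalEliminationSequence`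
(`IsReplayStep.support_eq_part`, `Labelling.mem_part_iff/subset_part`), `…SigmaBoundaryRuns` (p523856: `IsCanonicalStepΩE`, `StrategyE.ofStageOracleE`,
`StrategyE.isFunctional_ofStageOracleE`), `…SigmaMenuDiscipline` (p526241: `StrategyE.hybrid`, `hybrid_step_cases`, `IsFunctional.hybrid`),
`…WLadderStrataReplay` (stub-4's CJS (c-rep) and `strataReplayBlowupsSettle_of_cycleStartRegular`).
-/

noncomputable section

set_option linter.dupNamespace false

open CategoryTheory AlgebraicGeometry TopologicalSpace Topology
open Summit.ResolutionOfSingularities.ResolutionOfSingularities.Theorems.CampaignW42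
open Literature.AlgebraicGeometry.Resolution Literature.RingTheory.HilbertSamuel
open Literature.AlgebraicGeometry.CossartJannsenSaito2020
open Summit.ResolutionOfSingularities.ResolutionOfSingularities.Theorems.SigmaMaxModificationsCorridor3
open Summit.ResolutionOfSingularities.ResolutionOfSingularities.Theorems.SigmaMaxModificationsCorridor3.Moving

namespace Summit.ResolutionOfSingularities.ResolutionOfSingularities.Theorems.SigmaMaxModificationsCorridor3.Sigma

universe u

/-! ## §1. The two residual rows -/

/-- [OURS · L1 W4.2] **ROW (c-rep)From — LATE BLOW-UPS OF THE CHAIN POINT LEAD TO A STATE BETWEEN CYCLES, from `s₀`, for the boundary-reading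
strategy `σ`** (From-`s₀` σE-copy of stub-4's `StrataReplayBlowupsSettle` / brick 3a's `StrataReplayBlowupsSettleσ`): along every moving,
never-isolated `G`-chain of σE-steps whose start is σ-reached from `s₀`, from some stage on, whenever `x_n` is blown up the next state has `P = none`.
For the menu hybrid: late blow-ups of `x_n` are cycle ENDS of the fallback or policy steps emitting `none` — no late REPLAY step through `x_n`.
OURS row, OPEN as a binder; NOT a statement of the manuscript. [cite: CossartJannsenSaito2020, Rem. 6.29 (1), Prop. 6.31] -/
def StrataReplaySettleFromσE (σ : StrategyE.{u}) (N : ℕ) (ν : ℕ → ℕ) (s₀ : MarkedStageE.{u}) (G : MarkedStage.{u} → Prop) : Prop :=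
  ∀ c : ℕ → MarkedStageE.{u}, ReachesσE σ N ν s₀ (c 0) → (∀ n, CanonicalNearStepσE σ N ν (c n) (c (n + 1))) →
    (∀ n, G (c n).toMarkedStage) → (∀ n, ¬ Iso N (c n).toMarkedStage) → (∀ n, ∃ m, n ≤ m ∧ (c m).IsBlownUpσE σ N ν) →
    ∃ n₁, ∀ n, n₁ ≤ n → (c n).IsBlownUpσE σ N ν → (c (n + 1)).P = none

/-- [OURS · L1 W4.2] **ROW (c-menu)From — LATE POLICY STEPS THROUGH THE CHAIN POINT SWALLOW A STRATUM COMPONENT THROUGH IT**: along every moving,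
never-isolated `G`-chain of `σ`-steps whose start is σ-reached from `s₀`, from some stage on, every step the POLICY `π` proposes at the state of `X_n`
whose centre contains `x_n` contains SOME irreducible component of `X_n(ν)` through `x_n` (plan-1's (c-menu): «no late menu SUB-hit of `x_n`» — a menu
centre is a boundary stratum `Z ∩ ⋂ E_k ∩ X(ν)` through a corner; a sub-hit is a served CURVE inside a SURFACE component through the W-low point
`x_n`). Intended discharge (RULING v3.14-23: geometric trichotomy at a W-low `x_n ∈ Z`, served strata come in finite blocks) is the residual of
RULING (FW). OURS row, OPEN as a binder; NOT a statement of the manuscript. [cite: CossartJannsenSaito2020, Rem. 6.29 (1), Thm. 3.14] -/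
def StrataPolicySwallowFromσE (π σ : StrategyE.{u}) (N : ℕ) (ν : ℕ → ℕ) (s₀ : MarkedStageE.{u}) (G : MarkedStage.{u} → Prop) : Prop :=
  ∀ c : ℕ → MarkedStageE.{u}, ReachesσE σ N ν s₀ (c 0) → (∀ n, CanonicalNearStepσE σ N ν (c n) (c (n + 1))) →
    (∀ n, G (c n).toMarkedStage) → (∀ n, ¬ Iso N (c n).toMarkedStage) → (∀ n, ∃ m, n ≤ m ∧ (c m).IsBlownUpσE σ N ν) →
    ∃ n₁, ∀ n, n₁ ≤ n → ∀ (C : (c n).W.IdealSheafData) (P' : Option (Pending (blowup C))),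
      π.step (c n).W (c n).ln N ν (c n).L (c n).P (c n).E C P' → (c n).pt ∈ (C.support : Set (c n).W) →
        ∃ Z ∈ componentsThrough N ν (c n).toMarkedStage, Z ⊆ (C.support : Set (c n).W)

/-! ## §2. The END-type half: an ΩE step to a state between cycles swallows a stratum component through every point of its centre -/

section OmegaE

variable {ω : StageOracleE.{u}} {N : ℕ} {ν : ℕ → ℕ}

/-- **AN ΩE STEP WHOSE NEXT CYCLE STATE IS `none` BLOWS UP A WHOLE LABEL PART** — the END of a cycle (a replay step continues the cycle: `P' = some _`),
so its centre is the reduced structure on `Y^{(j)}` and contains, with every point `x ∈ V(C)`, the label-`j` component of the stratum through `x`.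
[cite: CossartJannsenSaito2020, Rem. 6.29 (1)] -/
theorem IsCanonicalStepΩE.exists_component_subset_of_none {W : Scheme.{u}} {hW : IsLocallyNoetherian W} {L : Labelling W}
    {E : Boundary W} {P : Option (Pending W)} {C : W.IdealSheafData} (h : IsCanonicalStepΩE ω hW N ν L E P C none) {x : W}
    (hx : x ∈ (C.support : Set W)) :
    ∃ Z ∈ componentsIn (Scheme.hsStratum W N ν), x ∈ Z ∧ Z ⊆ (C.support : Set W) := by
  have key : ∃ j, (C.support : Set W) = L.part (Scheme.hsStratum W N ν) j := by
    cases P with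
    | none =>
      obtain ⟨j, -, hcl, t, -, hrep⟩ := h
      cases t with
      | nil _ => exact ⟨j, hrep.support_eq_part⟩
      | cons D t' =>
        obtain ⟨-, φ', hφ', -, hsome⟩ := hrep
        exact absurd hsome (by simp)
    | some Q =>
      obtain ⟨-, hrep⟩ := h
      generalize hr : Q.rest = r at hrep
      cases r with
      | nil _ => exact ⟨Q.lbl, hrep.support_eq_part⟩
      | cons D t' =>
        obtain ⟨-, φ', hφ', -, hsome⟩ := hrep
        exact absurd hsome (by simp)
  obtain ⟨j, hj⟩ := key
  have hxj : x ∈ L.part (Scheme.hsStratum W N ν) j := hj ▸ hx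
  obtain ⟨Z, hZ, hl, hxZ⟩ := (L.mem_part_iff _ j x).mp hxj
  exact ⟨Z, hZ, hxZ, hj ▸ L.subset_part hZ hl⟩

end OmegaE

/-! ## §3. (c-swallow)From for the hybrid from (c-rep)From and (c-menu)From; E7's Low class at a maximal origin -/

section Hybrid

variable {π : StrategyE.{u}} {ω : StageOracleE.{u}} {N : ℕ} {ν : ℕ → ℕ} {s₀ : MarkedStageE.{u}} {G : MarkedStage.{u} → Prop}

/-- **(c-swallow)From FOR THE HYBRID `π.hybrid (ofStageOracleE ω)` FROM (c-rep)From AND (c-menu)From** (π and ω functional): a late step `(C, P')`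
allowed with `x_n ∈ V(C)` is a policy step (swallows by (c-menu)) or THE fallback step of the chain (functionality), whose next state is `none` by
(c-rep), hence a cycle END swallowing the label-`j` component through `x_n` (§2). [cite: CossartJannsenSaito2020, Rem. 6.29 (1), Prop. 6.31] -/
theorem strataSwallowFromσE_hybrid_of_replaySettle_menuSwallow (hπ : π.IsFunctional N ν) (hω : OracleFunctionalΩE ω)
    (hrep : StrataReplaySettleFromσE (π.hybrid (StrategyE.ofStageOracleE ω)) N ν s₀ G)
    (hmenu : StrataPolicySwallowFromσE π (π.hybrid (StrategyE.ofStageOracleE ω)) N ν s₀ G) :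
    StrataSwallowFromσE (π.hybrid (StrategyE.ofStageOracleE ω)) N ν s₀ G := by
  have hfun : (π.hybrid (StrategyE.ofStageOracleE ω)).IsFunctional N ν :=
    hπ.hybrid (StrategyE.isFunctional_ofStageOracleE hω N ν)
  intro c h0 hstep hG hnI hmov
  obtain ⟨n₁, hn₁⟩ := hrep c h0 hstep hG hnI hmov
  obtain ⟨n₂, hn₂⟩ := hmenu c h0 hstep hG hnI hmov
  refine ⟨max n₁ n₂, fun n hn C P' hcs hx => ?_⟩
  rcases StrategyE.hybrid_step_cases hcs with hπs | hτs
  · exact hn₂ n (le_trans (le_max_right _ _) hn) C P' hπs hx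
  · -- the fallback step IS the chain's step; its next state is `none` by (c-rep)
    have hnone : (c (n + 1)).P = none := hn₁ n (le_trans (le_max_left _ _) hn) ⟨C, P', hcs, hx⟩
    obtain ⟨C₀, P₀, hln, x', hcs₀, -, -, -, hc⟩ := hstep n
    have hP₀ : P₀ = none := by rw [hc] at hnone; exact hnone
    obtain rfl : C = C₀ := (hfun (c n).W (c n).ln (c n).L (c n).P (c n).E).1 C C₀ P' P₀ hcs hcs₀
    obtain rfl : P' = P₀ := (hfun (c n).W (c n).ln (c n).L (c n).P (c n).E).2 C P' P₀ hcs hcs₀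
    subst hP₀
    obtain ⟨Z, hZ, hxZ, hZC⟩ := IsCanonicalStepΩE.exists_component_subset_of_none hτs hx
    exact ⟨Z, ⟨hZ, hxZ⟩, hZC⟩

/-- **E7's LOW CLASS AT A MAXIMAL ORIGIN FOR THE MENU HYBRID, from four named rows** (π menu-free here: any functional policy; ω functional; the
hybrid admissible on its run-wise scope — E7/E8 supply this from `isAdmissibleStrategyOnE_hybrid_plus`): (b)From ∧ (c-rep)From ∧ (c-menu)From in
the W-low grade `ē < N` and the units binder give `∀ e < N, NoMovingNearChainFromσE (π.hybrid (ofStageOracleE ω)) N ν (init X x (E₀ X x)) (ē = e)`,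
`0 < N ≤ 3`, modulo the kill row. [cite: CossartJannsenSaito2020, Rem. 6.29 (1), Thm. 6.35, Thm. 6.40, p. 107] -/
theorem low_init_hybrid_of_rows (hK : LocalNearPointChainsTerminate.{u}) (hN0 : 0 < N) (hN3 : N ≤ 3)
    (hπ : π.IsFunctional N ν) (hω : OracleFunctionalΩE ω) {p : ℕ} {E₀ : ∀ (X : Scheme.{u}), X → Boundary X}
    (hadm : IsAdmissibleStrategyOnE (StrategyE.RunReachableState p (π.hybrid (StrategyE.ofStageOracleE ω)) N ν E₀) N ν
      (π.hybrid (StrategyE.ofStageOracleE ω)))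
    {X : Scheme.{u}} [IsLocallyNoetherian X] {x : X} (hX : IsMaximalOrigin p N ν X x)
    (hbirths : StrataBirthsSettleFromσE (π.hybrid (StrategyE.ofStageOracleE ω)) N ν (MarkedStageE.init X x (E₀ X x))
      fun s => s.geomDirDim < N)
    (hrep : StrataReplaySettleFromσE (π.hybrid (StrategyE.ofStageOracleE ω)) N ν (MarkedStageE.init X x (E₀ X x))
      fun s => s.geomDirDim < N)
    (hmenu : StrataPolicySwallowFromσE π (π.hybrid (StrategyE.ofStageOracleE ω)) N ν (MarkedStageE.init X x (E₀ X x))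
      fun s => s.geomDirDim < N)
    (hunits : NoMovingRecurrentNearChainFromσE (π.hybrid (StrategyE.ofStageOracleE ω)) N ν (MarkedStageE.init X x (E₀ X x))
      (fun s => s.geomDirDim < N) fun s => Iso N s) :
    ∀ e, e < N → NoMovingNearChainFromσE (π.hybrid (StrategyE.ofStageOracleE ω)) N ν (MarkedStageE.init X x (E₀ X x))
      fun s => s.geomDirDim = e :=
  low_init_of_births_swallow_units hK hN0 hN3 (hπ.hybrid (StrategyE.isFunctional_ofStageOracleE hω N ν)) hadm hX hbirths
    (strataSwallowFromσE_hybrid_of_replaySettle_menuSwallow hπ hω hrep hmenu) hunits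

end Hybrid

end Summit.ResolutionOfSingularities.ResolutionOfSingularities.Theorems.SigmaMaxModificationsCorridor3.Sigma

end
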